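import Literature.AnabelianGeometry.AbsoluteAnabelian.MonoidKummerModel
import Literature.AnabelianGeometry.AbsoluteAnabelian.MLFGaloisGroupification
import Literature.AnabelianGeometry.EtaleTheta.KummerFunctorialityCovariant

/-!
# Naturality of the MODEL Kummer maps of [AbsTopIII] Prop 3.2 (ii) along morphisms of `TM`-pairs

S. Mochizuki, *Topics in absolute anabelian geometry III*, §3, Prop. 3.2 (ii) p. 71 (bib key
`MochizukiAbsTopIII2015`; locators = kurims manuscript pages, lit key `paper:url-5493eb38cbb7`): "by
considering the action of open subgroups `H ⊆ Π` on elements of `M_TM` that are roots of elements of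
`M^H_TM`, we obtain a FUNCTORIAL algorithm for constructing … the Kummer maps
`M^H_TM → H¹(H, μ_Ẑ(M_TM))`", functorial "relative to `𝒞^MLF_T`" (Prop. 3.2 preamble p. 71 l. 15–17),
i.e. along the morphisms `φ = (φ_Π, φ_M) : (Π₁ ↷ M₁) → (Π₂ ↷ M₂)` of Def. 3.1 (ii) p. 67.

`MonoidKummerModel.lean` (seat abc-iut-L4-t2) CONSTRUCTS the Kummer theory of the model `TM`-pair
`(Π_k ↷ 𝒪_k̄^⊳)` out of real objects (`ModelMLFGaloisData.kummerTheory`, Kummer classes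
`EtaleTheta.kummerClass` in Mathlib's `groupCohomology.H1 (Λ(k̄ˣ))`); `MonoidKummerTransport.lean`
transports it along ISOMORPHISMS of pairs.  This file proves the functoriality clause for GENERAL (not
necessarily invertible) equivariant maps between model pairs — the clause recorded OPEN for the node in
the layer registry (abc-iut-L4-lead RULING #5f (3) / #5i (2), row «Prop32ii-NATURALITY-MODEL»):

* `ModelMLFGaloisData.unitsLift φ_M : k̄₁ˣ →* k̄₂ˣ` — the extension of a monoid homomorphism
  `φ_M : 𝒪_k̄₁^⊳ → 𝒪_k̄₂^⊳` to the groupifications `k̄ᵢˣ = (𝒪_k̄ᵢ^⊳)^gp` (abc-iut-L4-t2's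
  `gpEquivNonZeroDivisors`, Def. 3.1 (iii)), with `unitsLift_toUnit` (it extends `φ_M`) and
  `unitsLift_smul` (it is `φ_Π`-equivariant whenever `φ_M` is);
* `ModelMLFGaloisData.unitsMorphism φ_Π φ_M h` — the resulting covariant equivariant morphism
  `(Π₁ ↷ k̄₁ˣ) → (Π₂ ↷ k̄₂ˣ)` (`EtaleTheta.EquivariantMorphism`), hence the COSPAN of Mathlib
  `groupCohomology.map`s `H¹(H₁, Λ(k̄₁ˣ)) —push→ H¹(H₁, res_{φ_Π} Λ(k̄₂ˣ)) ←pull— H¹(H₂, Λ(k̄₂ˣ))` for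
  subgroups `H₁ ⊆ Π₁`, `H₂ ⊆ Π₂` with `φ_Π(H₁) ⊆ H₂` (`EtaleTheta/KummerFunctorialityCovariant.lean`);
  specialisations `GaloisMonoidPair.Hom.unitsMorphism` (morphisms of Def. 3.1 (ii)) and
  `GaloisMonoidPair.Iso.unitsMorphism` (isomorphisms of pairs);
* **`ModelMLFGaloisData.kummer_natural`** — for `m ∈ (𝒪_k̄₁^⊳)^{H₁}` with `φ_M(m) ∈ (𝒪_k̄₂^⊳)^{H₂}`:
  `pull (κ_{H₂}(φ_M m)) = push (κ_{H₁}(m))`, i.e. the Kummer maps of the two model Kummer theories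
  commute with `φ`; forms `GaloisMonoidPair.Hom.kummer_natural` (+ `_comap` at `H₁ := φ_Π⁻¹(H₂)`,
  `_map` at `H₂ := φ_Π(H₁)` open) and `GaloisMonoidPair.Iso.kummer_natural`.

Every input is a kernel theorem of the tree (abc-iut-L4-t2 model files + the EtaleTheta Kummer library);
Mathlib's `groupCohomology` is single-universe, so the cohomological statements live at universe `0`, as in
`MonoidKummerModel.lean`.  HONEST FRAMING: classical Kummer theory for `p`-adic fields at the MODEL; the
canonicity of the Kummer theory on an ABSTRACT MLF-Galois `TM`-pair (independence of the transporting
isomorphism) is a separate file; nothing here bears on [IUTchIII] Cor. 3.12; no side taken.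
-/

noncomputable section

namespace Literature.AnabelianGeometry.AbsoluteAnabelian

open _root_.Algebra
open Literature.AnabelianGeometry.EtaleTheta (kummerClass invariants cyclotomeRep EquivariantMorphism)

universe u

/-! ### `(𝒪_k̄^⊳)^gp = k̄ˣ` on units, and the extension of `φ_M` to `k̄ˣ` -/

namespace ModelMLFGaloisData

/-- **`(𝒪_k̄^⊳)^gp ⥲ k̄ˣ`**: abc-iut-L4-t2's `gpEquivNonZeroDivisors` (Def. 3.1 (iii): the groupification of
the model `TM`-monoid is `k̄^×`) followed by `k̄^× = nonZeroDivisors k̄ ≃ k̄ˣ`.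
[cite: MochizukiAbsTopIII2015, Definition 3.1 (iii) p.68] -/
def gpEquivUnits (C : MLFClosure.{u}) : GrothendieckGroup (nonzeroIntegers C.k C.K) ≃* (C.K)ˣ :=
  (gpEquivNonZeroDivisors C).trans nonZeroDivisorsEquivUnits

/-- `gpEquivUnits` extends `toUnit : 𝒪_k̄^⊳ → k̄ˣ`. [cite: MochizukiAbsTopIII2015, Definition 3.1 (iii) p.68] -/
@[simp] theorem gpEquivUnits_of (C : MLFClosure.{u}) (m : nonzeroIntegers C.k C.K) :
    gpEquivUnits C (GrothendieckGroup.of m) = toUnit m :=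
  Units.ext (by
    change (((nonZeroDivisorsEquivUnits (gpEquivNonZeroDivisors C (GrothendieckGroup.of m))) : (C.K)ˣ) :
        C.K) = (m : C.K)
    rw [nonZeroDivisorsEquivUnits_apply, Units.val_mk0, gpEquivNonZeroDivisors_apply,
      gpToNonZeroDivisors_of])

/-- Hence `gpEquivUnits⁻¹ (toUnit m) = [m]`. [cite: MochizukiAbsTopIII2015, Definition 3.1 (iii) p.68] -/
@[simp] theorem gpEquivUnits_symm_toUnit (C : MLFClosure.{u}) (m : nonzeroIntegers C.k C.K) :
    (gpEquivUnits C).symm (toUnit m) = GrothendieckGroup.of m :=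
  (gpEquivUnits C).symm_apply_eq.mpr (gpEquivUnits_of C m).symm

section Lift

variable {C₁ C₂ : MLFClosure.{u}}
  (φM : nonzeroIntegers C₁.k C₁.K →* nonzeroIntegers C₂.k C₂.K)

/-- **The extension of `φ_M : 𝒪_k̄₁^⊳ → 𝒪_k̄₂^⊳` to the groupifications**, `k̄₁ˣ → k̄₂ˣ` (universal property of
`(𝒪_k̄₁^⊳)^gp = k̄₁ˣ`; the object component of `φ` under the natural functor `𝒞_TM → 𝒞_TLG` of Def. 3.1
(iii), in unit coordinates). [cite: MochizukiAbsTopIII2015, Definition 3.1 (iii) p.68] -/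
def unitsLift : (C₁.K)ˣ →* (C₂.K)ˣ :=
  (GrothendieckGroup.lift (toUnitHom.comp φM)).comp (gpEquivUnits C₁).symm.toMonoidHom

/-- `unitsLift φ_M` extends `φ_M`: on `𝒪_k̄₁^⊳ ⊆ k̄₁ˣ` it is `toUnit ∘ φ_M`.
[cite: MochizukiAbsTopIII2015, Definition 3.1 (iii) p.68] -/
@[simp] theorem unitsLift_toUnit (m : nonzeroIntegers C₁.k C₁.K) :
    unitsLift φM (toUnit m) = toUnit (φM m) := by
  change GrothendieckGroup.lift (toUnitHom.comp φM) ((gpEquivUnits C₁).symm (toUnit m)) = _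
  rw [gpEquivUnits_symm_toUnit]
  exact (Localization.monoidOf ⊤).lift_eq _ m

/-- A homomorphism `k̄₁ˣ → k̄₂ˣ` is determined by its values on `𝒪_k̄₁^⊳` (which generates `k̄₁ˣ` as a group:
`k̄₁ˣ = (𝒪_k̄₁^⊳)^gp`). [cite: MochizukiAbsTopIII2015, Definition 3.1 (iii) p.68] -/
theorem unitsHom_ext {G : Type*} [Monoid G] {F₁ F₂ : (C₁.K)ˣ →* G}
    (h : ∀ m : nonzeroIntegers C₁.k C₁.K, F₁ (toUnit m) = F₂ (toUnit m)) : F₁ = F₂ := by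
  have key : F₁.comp (gpEquivUnits C₁).toMonoidHom = F₂.comp (gpEquivUnits C₁).toMonoidHom := by
    apply gp_monoidHom_ext
    ext m : 1
    change F₁ (gpEquivUnits C₁ (GrothendieckGroup.of m)) = F₂ (gpEquivUnits C₁ (GrothendieckGroup.of m))
    rw [gpEquivUnits_of]
    exact h m
  ext u : 1
  have hk := congrArg (fun F : GrothendieckGroup (nonzeroIntegers C₁.k C₁.K) →* G =>
    F ((gpEquivUnits C₁).symm u)) key
  simpa using hk

/-- `unitsLift φ_M` is the UNIQUE homomorphism `k̄₁ˣ → k̄₂ˣ` extending `φ_M`.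
[cite: MochizukiAbsTopIII2015, Definition 3.1 (iii) p.68] -/
theorem unitsLift_unique (F : (C₁.K)ˣ →* (C₂.K)ˣ)
    (hF : ∀ m : nonzeroIntegers C₁.k C₁.K, F (toUnit m) = toUnit (φM m)) : F = unitsLift φM :=
  unitsHom_ext fun m => by rw [hF, unitsLift_toUnit]

variable {D₁ : ModelMLFGaloisData C₁.k C₁.K} {D₂ : ModelMLFGaloisData C₂.k C₂.K}
  (φP : D₁.Pi →* D₂.Pi) (hφ : ∀ (g : D₁.Pi) (m : nonzeroIntegers C₁.k C₁.K), φM (g • m) = φP g • φM m)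

include hφ in
/-- `unitsLift φ_M` is `φ_Π`-equivariant as soon as `φ_M` is: `unitsLift (g • u) = φ_Π(g) • unitsLift u`
(both sides are homomorphisms in `u` agreeing on `𝒪_k̄₁^⊳`).
[cite: MochizukiAbsTopIII2015, Definition 3.1 (ii) p.67] -/
theorem unitsLift_smul (g : D₁.Pi) (u : (C₁.K)ˣ) : unitsLift φM (g • u) = φP g • unitsLift φM u := by
  have key : (unitsLift φM).comp (MulDistribMulAction.toMonoidHom (C₁.K)ˣ g) =
      (MulDistribMulAction.toMonoidHom (C₂.K)ˣ (φP g)).comp (unitsLift φM) := by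
    refine unitsHom_ext fun m => ?_
    change unitsLift φM (g • toUnit m) = φP g • unitsLift φM (toUnit m)
    rw [D₁.smul_toUnit, unitsLift_toUnit, unitsLift_toUnit, D₂.smul_toUnit, hφ]
  exact DFunLike.congr_fun key u

/-- **The covariant equivariant morphism `(Π₁ ↷ k̄₁ˣ) → (Π₂ ↷ k̄₂ˣ)` determined by an equivariant pair
`(φ_Π, φ_M)` on the model `TM`-pairs** (`φ_Π` and the groupified `φ_M`): the input of the cohomological
functoriality `EtaleTheta.EquivariantMorphism`. [cite: MochizukiAbsTopIII2015, Definition 3.1 (ii) p.67] -/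
def unitsMorphism : EquivariantMorphism D₁.Pi (C₁.K)ˣ D₂.Pi (C₂.K)ˣ where
  groupHom := φP
  map := unitsLift φM
  map_smul := unitsLift_smul φM φP hφ

/-- The group component of `unitsMorphism` is `φ_Π`. [cite: MochizukiAbsTopIII2015, Definition 3.1 (ii) p.67] -/
@[simp] theorem unitsMorphism_groupHom : (unitsMorphism φM φP hφ).groupHom = φP := rfl

/-- The module component of `unitsMorphism` is `unitsLift φ_M`. [cite: MochizukiAbsTopIII2015, Definition 3.1 (ii) p.67] -/
@[simp] theorem unitsMorphism_map : (unitsMorphism φM φP hφ).map = unitsLift φM := rfl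

end Lift

/-! ### Naturality of the model Kummer maps -/

section Natural

variable {C₁ C₂ : MLFClosure.{0}} {D₁ : ModelMLFGaloisData C₁.k C₁.K} {D₂ : ModelMLFGaloisData C₂.k C₂.K}
  (φP : D₁.Pi →* D₂.Pi) (φM : nonzeroIntegers C₁.k C₁.K →* nonzeroIntegers C₂.k C₂.K)
  (hφ : ∀ (g : D₁.Pi) (m : nonzeroIntegers C₁.k C₁.K), φM (g • m) = φP g • φM m)

/-- **[AbsTopIII] Prop 3.2 (ii), functoriality of the Kummer maps, at the MODEL.**  Let
`(φ_Π, φ_M) : (Π₁ ↷ 𝒪_k̄₁^⊳) → (Π₂ ↷ 𝒪_k̄₂^⊳)` be an equivariant pair of homomorphisms between model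
`TM`-pairs (e.g. a morphism of Def. 3.1 (ii)), `H₁ ⊆ Π₁`, `H₂ ⊆ Π₂` open subgroups with `φ_Π(H₁) ⊆ H₂`, and
`m ∈ (𝒪_k̄₁^⊳)^{H₁}` with `φ_M(m) ∈ (𝒪_k̄₂^⊳)^{H₂}`.  Then the Kummer classes of the two model Kummer
theories (`ModelMLFGaloisData.kummerTheory`) satisfy
`φ_Π^* (κ_{H₂}(φ_M m)) = (φ_M)_* (κ_{H₁}(m))` in `H¹(H₁, res_{φ_Π} Λ(k̄₂ˣ))`
— the pull-back along `φ_Π| : H₁ → H₂` of the class of `φ_M(m)` is the push-forward along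
`Λ(φ_M) : Λ(k̄₁ˣ) → Λ(k̄₂ˣ)` of the class of `m` ("we obtain a functorial algorithm for constructing …
the Kummer maps `M^H_TM → H¹(H, μ_Ẑ(M_TM))`").
[cite: MochizukiAbsTopIII2015, Proposition 3.2 (ii) p.71] -/
theorem kummer_natural (H₁ : OpenSubgroup D₁.tmPair.Pi) (H₂ : OpenSubgroup D₂.tmPair.Pi)
    (hH : (H₁ : Subgroup D₁.Pi).map φP ≤ (H₂ : Subgroup D₂.Pi))
    (m : {m : D₁.tmPair.M // ∀ h : H₁, (h : D₁.tmPair.Pi) • m = m})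
    (hm : ∀ h : H₂, (h : D₂.tmPair.Pi) • φM m.1 = φM m.1) :
    (unitsMorphism φM φP hφ).pullH1 hH ((D₂.kummerTheory C₂).kummer H₂ ⟨φM m.1, hm⟩) =
      (unitsMorphism φM φP hφ).pushH1 hH ((D₁.kummerTheory C₁).kummer H₁ m) := by
  rw [kummerTheory_kummer, kummerTheory_kummer]
  exact (unitsMorphism φM φP hφ).pullH1_kummerClass hH (D₁.invariantUnit C₁ H₁ m)
    (D₂.invariantUnit C₂ H₂ ⟨φM m.1, hm⟩) (unitsLift_toUnit φM m.1)

end Natural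

end ModelMLFGaloisData

/-! ### Morphisms and isomorphisms of the model `TM`-pairs (Def 3.1 (ii)) -/

namespace GaloisMonoidPair

open ModelMLFGaloisData

section Hom

variable {C₁ C₂ : MLFClosure.{u}} {D₁ : ModelMLFGaloisData C₁.k C₁.K} {D₂ : ModelMLFGaloisData C₂.k C₂.K}
  (f : GaloisMonoidPair.Hom D₁.tmPair D₂.tmPair)

/-- The equivariant morphism `(Π₁ ↷ k̄₁ˣ) → (Π₂ ↷ k̄₂ˣ)` underlying a morphism `φ` of the model `TM`-pairs
(Def. 3.1 (ii)). [cite: MochizukiAbsTopIII2015, Definition 3.1 (ii) p.67] -/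
abbrev Hom.unitsMorphism : EquivariantMorphism D₁.Pi (C₁.K)ˣ D₂.Pi (C₂.K)ˣ :=
  ModelMLFGaloisData.unitsMorphism f.homM f.homPi f.smul_comm

/-- The preimage `φ_Π⁻¹(H₂)` of an open subgroup under the (continuous) `φ_Π`, as an open subgroup of `Π₁`.
[cite: MochizukiAbsTopIII2015, Definition 3.1 (ii) p.67] -/
def Hom.comapOpen (H₂ : OpenSubgroup D₂.tmPair.Pi) : OpenSubgroup D₁.tmPair.Pi :=
  ⟨(H₂ : Subgroup D₂.Pi).comap f.homPi, H₂.isOpen.preimage f.continuous_homPi⟩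

/-- Membership in `comapOpen`. [cite: MochizukiAbsTopIII2015, Definition 3.1 (ii) p.67] -/
@[simp] theorem Hom.mem_comapOpen (H₂ : OpenSubgroup D₂.tmPair.Pi) (g : D₁.Pi) :
    g ∈ f.comapOpen H₂ ↔ f.homPi g ∈ H₂ :=
  Iff.rfl

/-- `φ_Π(φ_Π⁻¹(H₂)) ⊆ H₂`. [cite: MochizukiAbsTopIII2015, Definition 3.1 (ii) p.67] -/
theorem Hom.map_comapOpen_le (H₂ : OpenSubgroup D₂.tmPair.Pi) :
    ((f.comapOpen H₂ : OpenSubgroup D₁.tmPair.Pi) : Subgroup D₁.Pi).map f.homPi ≤ (H₂ : Subgroup D₂.Pi) :=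
  Subgroup.map_comap_le _ _

/-- `φ_M` carries `H₁`-invariants to `φ_Π(H₁)`-invariants.
[cite: MochizukiAbsTopIII2015, Definition 3.1 (ii) p.67] -/
theorem Hom.smul_homM_of_mem {H₁ : Subgroup D₁.Pi} (m : D₁.tmPair.M)
    (hm : ∀ h : H₁, (h : D₁.tmPair.Pi) • m = m) (h₁ : D₁.Pi) (hh₁ : h₁ ∈ H₁) :
    f.homPi h₁ • f.homM m = f.homM m := by
  rw [← f.smul_comm, hm ⟨h₁, hh₁⟩]

end Hom

section Iso

variable {C₁ C₂ : MLFClosure.{u}} {D₁ : ModelMLFGaloisData C₁.k C₁.K} {D₂ : ModelMLFGaloisData C₂.k C₂.K}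
  (e : GaloisMonoidPair.Iso D₁.tmPair D₂.tmPair)

/-- The equivariant morphism `(Π₁ ↷ k̄₁ˣ) → (Π₂ ↷ k̄₂ˣ)` underlying an ISOMORPHISM `e` of the model
`TM`-pairs (Def. 3.1 (ii)). [cite: MochizukiAbsTopIII2015, Definition 3.1 (ii) p.67] -/
abbrev Iso.unitsMorphism : EquivariantMorphism D₁.Pi (C₁.K)ˣ D₂.Pi (C₂.K)ˣ :=
  ModelMLFGaloisData.unitsMorphism e.isoM.toMonoidHom e.isoPi.toMonoidHom e.smul_comm

/-- For an isomorphism of pairs, `e_M(m)` is `e_Π(H₁)`-invariant iff … — direct form: `e_M` carries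
`H₁`-invariants to `e_Π(H₁)`-invariants. [cite: MochizukiAbsTopIII2015, Definition 3.1 (ii) p.67] -/
theorem Iso.smul_isoM_of_mem {H₁ : Subgroup D₁.Pi} (m : D₁.tmPair.M)
    (hm : ∀ h : H₁, (h : D₁.tmPair.Pi) • m = m) (h₁ : D₁.Pi) (hh₁ : h₁ ∈ H₁) :
    e.isoPi h₁ • e.isoM m = e.isoM m := by
  rw [← e.smul_comm, hm ⟨h₁, hh₁⟩]

end Iso

section Natural

variable {C₁ C₂ : MLFClosure.{0}} {D₁ : ModelMLFGaloisData C₁.k C₁.K} {D₂ : ModelMLFGaloisData C₂.k C₂.K}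

/-- **Prop 3.2 (ii) naturality along a morphism `φ` of the model `TM`-pairs** (Def. 3.1 (ii)): for open
`H₁ ⊆ Π₁`, `H₂ ⊆ Π₂` with `φ_Π(H₁) ⊆ H₂` and `m ∈ (𝒪_k̄₁^⊳)^{H₁}` with `φ_M(m) ∈ (𝒪_k̄₂^⊳)^{H₂}`,
`φ_Π^* (κ_{H₂}(φ_M m)) = (φ_M)_* (κ_{H₁}(m))`. [cite: MochizukiAbsTopIII2015, Proposition 3.2 (ii) p.71] -/
theorem Hom.kummer_natural (f : GaloisMonoidPair.Hom D₁.tmPair D₂.tmPair)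
    (H₁ : OpenSubgroup D₁.tmPair.Pi) (H₂ : OpenSubgroup D₂.tmPair.Pi)
    (hH : (H₁ : Subgroup D₁.Pi).map f.homPi ≤ (H₂ : Subgroup D₂.Pi))
    (m : {m : D₁.tmPair.M // ∀ h : H₁, (h : D₁.tmPair.Pi) • m = m})
    (hm : ∀ h : H₂, (h : D₂.tmPair.Pi) • f.homM m.1 = f.homM m.1) :
    f.unitsMorphism.pullH1 hH ((D₂.kummerTheory C₂).kummer H₂ ⟨f.homM m.1, hm⟩) =
      f.unitsMorphism.pushH1 hH ((D₁.kummerTheory C₁).kummer H₁ m) :=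
  ModelMLFGaloisData.kummer_natural f.homPi f.homM f.smul_comm H₁ H₂ hH m hm

/-- **Prop 3.2 (ii) naturality at `H₁ := φ_Π⁻¹(H₂)`**: for an open `H₂ ⊆ Π₂` and
`m ∈ (𝒪_k̄₁^⊳)^{φ_Π⁻¹(H₂)}` whose image `φ_M(m)` is `H₂`-invariant,
`φ_Π^* (κ_{H₂}(φ_M m)) = (φ_M)_* (κ_{φ_Π⁻¹ H₂}(m))`.
[cite: MochizukiAbsTopIII2015, Proposition 3.2 (ii) p.71] -/
theorem Hom.kummer_natural_comap (f : GaloisMonoidPair.Hom D₁.tmPair D₂.tmPair)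
    (H₂ : OpenSubgroup D₂.tmPair.Pi)
    (m : {m : D₁.tmPair.M // ∀ h : f.comapOpen H₂, (h : D₁.tmPair.Pi) • m = m})
    (hm : ∀ h : H₂, (h : D₂.tmPair.Pi) • f.homM m.1 = f.homM m.1) :
    f.unitsMorphism.pullH1 (f.map_comapOpen_le H₂) ((D₂.kummerTheory C₂).kummer H₂ ⟨f.homM m.1, hm⟩) =
      f.unitsMorphism.pushH1 (f.map_comapOpen_le H₂) ((D₁.kummerTheory C₁).kummer (f.comapOpen H₂) m) :=
  f.kummer_natural (f.comapOpen H₂) H₂ (f.map_comapOpen_le H₂) m hm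

/-- **Prop 3.2 (ii) naturality when `H₂ = φ_Π(H₁)` is itself open** (e.g. `φ_Π` an open embedding): then
`φ_M(m)` is automatically `H₂`-invariant for `m ∈ (𝒪_k̄₁^⊳)^{H₁}`, and
`φ_Π^* (κ_{φ_Π H₁}(φ_M m)) = (φ_M)_* (κ_{H₁}(m))` with no further hypothesis.
[cite: MochizukiAbsTopIII2015, Proposition 3.2 (ii) p.71] -/
theorem Hom.kummer_natural_map (f : GaloisMonoidPair.Hom D₁.tmPair D₂.tmPair)
    (H₁ : OpenSubgroup D₁.tmPair.Pi)
    (hopen : IsOpen (((H₁ : Subgroup D₁.Pi).map f.homPi : Subgroup D₂.Pi) : Set D₂.Pi))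
    (m : {m : D₁.tmPair.M // ∀ h : H₁, (h : D₁.tmPair.Pi) • m = m}) :
    f.unitsMorphism.pullH1 (H₂ := ((⟨(H₁ : Subgroup D₁.Pi).map f.homPi, hopen⟩ :
        OpenSubgroup D₂.tmPair.Pi) : Subgroup D₂.Pi)) le_rfl
        ((D₂.kummerTheory C₂).kummer ⟨(H₁ : Subgroup D₁.Pi).map f.homPi, hopen⟩
          ⟨f.homM m.1, by
            rintro ⟨_, h₁, hh₁, rfl⟩
            exact f.smul_homM_of_mem m.1 m.2 h₁ hh₁⟩) =
      f.unitsMorphism.pushH1 (H₂ := ((⟨(H₁ : Subgroup D₁.Pi).map f.homPi, hopen⟩ :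
        OpenSubgroup D₂.tmPair.Pi) : Subgroup D₂.Pi)) le_rfl ((D₁.kummerTheory C₁).kummer H₁ m) :=
  f.kummer_natural H₁ ⟨(H₁ : Subgroup D₁.Pi).map f.homPi, hopen⟩ le_rfl m _

/-- The image of an open subgroup under an isomorphism of topological groups, as an open subgroup.
[cite: MochizukiAbsTopIII2015, Definition 3.1 (ii) p.67] -/
def Iso.mapOpen (e : GaloisMonoidPair.Iso D₁.tmPair D₂.tmPair) (H₁ : OpenSubgroup D₁.tmPair.Pi) :
    OpenSubgroup D₂.tmPair.Pi :=
  ⟨(H₁ : Subgroup D₁.Pi).map e.isoPi.toMonoidHom, e.isoPi.isOpenMap _ H₁.isOpen⟩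

/-- The underlying subgroup of `Iso.mapOpen`. [cite: MochizukiAbsTopIII2015, Definition 3.1 (ii) p.67] -/
@[simp] theorem Iso.coe_mapOpen (e : GaloisMonoidPair.Iso D₁.tmPair D₂.tmPair)
    (H₁ : OpenSubgroup D₁.tmPair.Pi) :
    ((e.mapOpen H₁ : OpenSubgroup D₂.tmPair.Pi) : Subgroup D₂.Pi) =
      (H₁ : Subgroup D₁.Pi).map e.isoPi.toMonoidHom :=
  rfl

/-- **Prop 3.2 (ii) naturality along an ISOMORPHISM `e` of the model `TM`-pairs**, at `H₂ := e_Π(H₁)`: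
for every open `H₁ ⊆ Π₁` and `m ∈ (𝒪_k̄₁^⊳)^{H₁}`,
`e_Π^* (κ_{e_Π H₁}(e_M m)) = (e_M)_* (κ_{H₁}(m))` — the comparison underlying the canonicity of the
transported Kummer theories of `MonoidKummerTransport.lean`.
[cite: MochizukiAbsTopIII2015, Proposition 3.2 (ii) p.71] -/
theorem Iso.kummer_natural (e : GaloisMonoidPair.Iso D₁.tmPair D₂.tmPair)
    (H₁ : OpenSubgroup D₁.tmPair.Pi) (m : {m : D₁.tmPair.M // ∀ h : H₁, (h : D₁.tmPair.Pi) • m = m}) :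
    e.unitsMorphism.pullH1 (H₂ := (e.mapOpen H₁ : Subgroup D₂.Pi)) le_rfl
        ((D₂.kummerTheory C₂).kummer (e.mapOpen H₁)
          ⟨e.isoM m.1, by
            rintro ⟨_, h₁, hh₁, rfl⟩
            exact e.smul_isoM_of_mem m.1 m.2 h₁ hh₁⟩) =
      e.unitsMorphism.pushH1 (H₂ := (e.mapOpen H₁ : Subgroup D₂.Pi)) le_rfl
        ((D₁.kummerTheory C₁).kummer H₁ m) :=
  ModelMLFGaloisData.kummer_natural e.isoPi.toMonoidHom e.isoM.toMonoidHom e.smul_comm H₁ (e.mapOpen H₁)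
    le_rfl m _

end Natural

end GaloisMonoidPair

end Literature.AnabelianGeometry.AbsoluteAnabelian

end
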